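import Mathlib
import Literature.Analysis.FluidPDE.GaussianVortexPlanar
import Literature.Analysis.FluidPDE.GaussianVortexPlanarProofs
import Literature.Analysis.FluidPDE.BiotSavart2DSymmetry
import Summits.AnomalousDissipation.AnomalousDissipation.Theorems.MarginalStabilityChainStretchedVortexRowsStubCoreInverseTools
import Summits.AnomalousDissipation.AnomalousDissipation.Theorems.MarginalStabilityChainStretchedVortexRowsStubCoreInverseStrainForm
import Summits.AnomalousDissipation.AnomalousDissipation.Theorems.MarginalStabilityChainStretchedVortexRowsStubCoreInverseBurgersPhi
import Summits.AnomalousDissipation.AnomalousDissipation.Theorems.MarginalStabilityChainStretchedVortexRowsStubCoreLEnergyGapMoment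
import Summits.AnomalousDissipation.AnomalousDissipation.Theorems.MarginalStabilityChainStretchedVortexRowsStubCoreLEnergyGapYControl
import Summits.AnomalousDissipation.AnomalousDissipation.Theorems.MarginalStabilityChainStretchedVortexRowsStubCoreStrainPairingTools
import HarnessLib

/-!
# Helper `coreStrain_pairing_bounds` toward stub `stub_coreInverse` of the line `braid-closed-large-circulation-gluing`
# (crux stmt-AnomalousDissipation-3009, `MarginalStabilityChain.StretchedVortexRows`)

The two STRAIN cross terms of the energy method for the cut-off core operator at the Gaussian vortex
`G = (4π)⁻¹e^{−|ξ|²/4}`: with `Bξ = (b₁ξ₀ + b₂ξ₁, b₂ξ₀ − b₁ξ₁)` (trace-free, `b₁² + b₂² ≤ β²`), a smooth radial cut-off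
`χ` (`= 1` on `|ξ| ≤ R`, `= 0` on `|ξ| ≥ 2R`, `0 ≤ χ ≤ 1`, `‖Dχ‖ ≤ 4/R`, `R ≥ 1`), `Sw = χ Bξ·∇w + (∇χ·Bξ) w`,
`w = G u` (`u ∈ C¹`, `u, Du` bounded), `Ω = (8π)⁻¹φ(|ξ|²/4)` and `Θ = ∫ G⁻¹ Ω (∂_θw)²` (`∂_θw = Dw[ξ^⊥]`):

  `|⟨Sw, w⟩_{L²(G⁻¹)}| ≤ 40 β R³ ‖w‖_{L²(G⁻¹)} Θ^{1/2}`,  `|⟨Sw, ∂_θw⟩_{L²(G⁻¹)}| ≤ 80 β R² ‖w‖_Y Θ^{1/2}`,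

together with the integrability of both pairings (continuous integrands supported in `|ξ| ≤ 2R`).

Proof. On the support, `Ω ≥ 1/(64R²)` (`φ(t) ≥ 1/(1+t)`, `π ≤ 4`). The second bound is the weighted Cauchy–Schwarz
inequality `|∫ G⁻¹ Sw ∂_θw| ≤ (∫ G⁻¹Ω⁻¹ Sw²)^{1/2} Θ^{1/2}` with `|Sw| ≤ 2βR‖∇w‖ + 8β|w|` (`‖Bξ‖ ≤ β|ξ| ≤ 2βR`,
`‖∇χ‖ ≤ 4/R`), `(2Ra + 8b)² ≤ 68R²(a² + b²)` and `68·64 ≤ 80²`. The first bound needs the STRUCTURE of the strain: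
by the landed form identity (`coreStrain_form_identity`) `⟨Sw, w⟩ = ∫ G⁻¹ w² P`, `P = ½∇χ·Bξ − ¼χ ξ·Bξ`; writing the
radial cut-off as `χ = ψ(|ξ|²)` (`exists_sqProfile_of_radial`, so `∇χ = 2ψ′(|ξ|²) ξ`) gives `P = m ⟪ξ, Bξ⟫` with the
RADIAL multiplier `m = ψ′(|ξ|²) − ψ(|ξ|²)/4`, and `⟪ξ, Bξ⟫ = ∂_θ q` for `q = b₁ξ₀ξ₁ + (b₂/2)(ξ₁² − ξ₀²)`; one angular
integration by parts (`∂_θ(m G⁻¹) = 0`, `∫ ∂_θ(·) = 0`) turns the potential term into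
`⟨Sw, w⟩ = −2 ∫ m q G⁻¹ w ∂_θw`, and `|m q| ≤ (5/2)βR²` on the support (`|ψ′(|ξ|²)| |ξ| ≤ 2/R`, `|q| ≤ β|ξ|²/2`),
so Cauchy–Schwarz gives the constant `2 · (5/2) · √64 = 40`. The point of both bounds is the factor `Θ^{1/2}`:
the strain couples only to the angular derivative, which the fast rotation controls (`stub_coreInverse`).

References: Th. Gallay, C. E. Wayne, Comm. Math. Phys. 255 (2005) §4; Th. Gallay, Y. Maekawa, arXiv:1610.08384 §4.1
(the operator `M = ½(x₁∂₁ − x₂∂₂)` and its conjugated potential).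
-/

set_option linter.dupNamespace false

noncomputable section

open scoped RealInnerProductSpace Topology ContDiff
open MeasureTheory WithLp Function Metric Filter Set

namespace Summit.AnomalousDissipation.AnomalousDissipation.Theorems.MarginalStabilityChainStretchedVortexRows

open Literature.Analysis.FluidPDE

/-- **Strain pairing bounds (H7) for the core energy method.** With `Bξ = (b₁ξ₀ + b₂ξ₁, b₂ξ₀ − b₁ξ₁)`,
`Sw = χ Bξ·∇w + (∇χ·Bξ) w`, `w = G u`, `Θ = ∫ G⁻¹Ω(Dw[ξ^⊥])²`: both pairings are integrable,
`|⟨Sw, w⟩_{L²(G⁻¹)}| ≤ 40 β R³ ‖w‖_{L²(G⁻¹)} Θ^{1/2}` and `|⟨Sw, ∂_θw⟩_{L²(G⁻¹)}| ≤ 80 β R² ‖w‖_Y Θ^{1/2}`. [folklore] -/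
theorem coreStrain_pairing_bounds :
    ∀ (b₁ b₂ β R : ℝ) (χ u : EuclideanSpace ℝ (Fin 2) → ℝ), 0 ≤ β → b₁ ^ 2 + b₂ ^ 2 ≤ β ^ 2 → 1 ≤ R →
      (ContDiff ℝ ∞ χ ∧ (∀ ξ η, ‖ξ‖ = ‖η‖ → χ ξ = χ η) ∧ (∀ ξ, ‖ξ‖ ≤ R → χ ξ = 1) ∧
        (∀ ξ, 2 * R ≤ ‖ξ‖ → χ ξ = 0) ∧ (∀ ξ, 0 ≤ χ ξ ∧ χ ξ ≤ 1) ∧ (∀ ξ, ‖fderiv ℝ χ ξ‖ ≤ 4 / R)) →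
      ContDiff ℝ 1 u → (∃ M : ℝ, ∀ ξ, |u ξ| ≤ M ∧ ‖fderiv ℝ u ξ‖ ≤ M) →
      let w : EuclideanSpace ℝ (Fin 2) → ℝ := fun η => gaussVortexProfile η * u η
      let Sw : EuclideanSpace ℝ (Fin 2) → ℝ := fun ξ =>
        χ ξ * ⟪toLp 2 ![b₁ * ξ 0 + b₂ * ξ 1, b₂ * ξ 0 - b₁ * ξ 1], gradient w ξ⟫ +
          ⟪gradient χ ξ, toLp 2 ![b₁ * ξ 0 + b₂ * ξ 1, b₂ * ξ 0 - b₁ * ξ 1]⟫ * w ξ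
      let Θ : ℝ := ∫ ξ, (gaussVortexProfile ξ)⁻¹ * ((8 * Real.pi)⁻¹ * burgersPhi (‖ξ‖ ^ 2 / 4)) *
        (fderiv ℝ w ξ (perp ξ)) ^ 2
      Integrable (fun ξ => (gaussVortexProfile ξ)⁻¹ * Sw ξ * w ξ) ∧
        Integrable (fun ξ => (gaussVortexProfile ξ)⁻¹ * Sw ξ * fderiv ℝ w ξ (perp ξ)) ∧
        |∫ ξ, (gaussVortexProfile ξ)⁻¹ * Sw ξ * w ξ| ≤
          40 * β * R ^ 3 * Real.sqrt (∫ ξ, (gaussVortexProfile ξ)⁻¹ * w ξ ^ 2) * Real.sqrt Θ ∧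
        |∫ ξ, (gaussVortexProfile ξ)⁻¹ * Sw ξ * fderiv ℝ w ξ (perp ξ)| ≤
          80 * β * R ^ 2 * Real.sqrt (∫ ξ, (gaussVortexProfile ξ)⁻¹ * (w ξ ^ 2 + ‖gradient w ξ‖ ^ 2)) *
            Real.sqrt Θ := by
  intro b₁ b₂ β R χ u hβ hb hR hχ hu hM w Sw Θ
  obtain ⟨hχs, hχrad, hχ1, hχ0, hχ01, hχD⟩ := hχ
  obtain ⟨M, hM⟩ := hM
  have h0 : ∀ x, |u x| ≤ M := fun x => (hM x).1
  have h1 : ∀ x, ‖fderiv ℝ u x‖ ≤ M := fun x => (hM x).2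
  have hR0 : 0 < R := by linarith
  have hRne : R ≠ 0 := hR0.ne'
  have h80 : 0 ≤ 80 * β * R ^ 2 := mul_nonneg (mul_nonneg (by norm_num) hβ) (pow_nonneg hR0.le 2)
  have h40 : 0 ≤ 40 * β * R ^ 3 := mul_nonneg (mul_nonneg (by norm_num) hβ) (pow_nonneg hR0.le 3)
  obtain ⟨ψ, hψs, hψdef, hχψ, hχd⟩ := exists_sqProfile_of_radial R χ hR0 hχs hχrad hχ1
  -- ### general continuity / positivity facts
  have hGpos : ∀ ξ : EuclideanSpace ℝ (Fin 2), 0 < gaussVortexProfile ξ := gaussVortexProfile_pos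
  have hGinvC : ContDiff ℝ 1 fun ξ : EuclideanSpace ℝ (Fin 2) => (gaussVortexProfile ξ)⁻¹ :=
    contDiff_gaussVortexProfile.inv fun ξ => (hGpos ξ).ne'
  have hw1 : ContDiff ℝ 1 w := contDiff_gaussVortexProfile.mul hu
  have hwc : Continuous w := hw1.continuous
  have hDc : Continuous fun ξ => fderiv ℝ w ξ (perp ξ) :=
    (hw1.continuous_fderiv one_ne_zero).clm_apply continuous_perp
  have hgradwc : Continuous (gradient w) :=
    (InnerProductSpace.toDual ℝ (EuclideanSpace ℝ (Fin 2))).symm.continuous.comp (hw1.continuous_fderiv one_ne_zero)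
  have hχ1' : ContDiff ℝ 1 χ := hχs.of_le (mod_cast le_top)
  have hgradχc : Continuous (gradient χ) :=
    (InnerProductSpace.toDual ℝ (EuclideanSpace ℝ (Fin 2))).symm.continuous.comp (hχ1'.continuous_fderiv one_ne_zero)
  have hVc : Continuous fun ξ : EuclideanSpace ℝ (Fin 2) =>
      toLp 2 ![b₁ * ξ 0 + b₂ * ξ 1, b₂ * ξ 0 - b₁ * ξ 1] := by fun_prop
  have hΩc : Continuous fun ξ : EuclideanSpace ℝ (Fin 2) => (8 * Real.pi)⁻¹ * burgersPhi (‖ξ‖ ^ 2 / 4) :=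
    continuous_const.mul ((contDiff_burgersPhi (n := 0)).continuous.comp (by fun_prop))
  have h8π : 0 ≤ (8 * Real.pi)⁻¹ := by positivity
  have hΩpos : ∀ ξ : EuclideanSpace ℝ (Fin 2), 0 < (8 * Real.pi)⁻¹ * burgersPhi (‖ξ‖ ^ 2 / 4) := fun ξ =>
    mul_pos (by positivity) (burgersPhi_pos _)
  have hWpos : ∀ ξ : EuclideanSpace ℝ (Fin 2),
      0 < (gaussVortexProfile ξ)⁻¹ * ((8 * Real.pi)⁻¹ * burgersPhi (‖ξ‖ ^ 2 / 4)) := fun ξ =>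
    mul_pos (inv_pos.2 (hGpos ξ)) (hΩpos ξ)
  have hK : IsCompact (closedBall (0 : EuclideanSpace ℝ (Fin 2)) (2 * R)) := isCompact_closedBall _ _
  have hout : ∀ ξ, ξ ∉ closedBall (0 : EuclideanSpace ℝ (Fin 2)) (2 * R) → 2 * R < ‖ξ‖ := fun ξ hξ => by
    simpa [dist_zero_right] using hξ
  -- ### the angular derivative of `w = G u`, and the basic integrands
  have hDw : ∀ ξ, fderiv ℝ w ξ (perp ξ) = gaussVortexProfile ξ * fderiv ℝ u ξ (perp ξ) := by
    intro ξ
    have hGd : HasFDerivAt gaussVortexProfile (fderiv ℝ gaussVortexProfile ξ) ξ :=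
      ((contDiff_gaussVortexProfile (n := 1)).differentiable one_ne_zero ξ).hasFDerivAt
    have hud : HasFDerivAt u (fderiv ℝ u ξ) ξ := (hu.differentiable one_ne_zero ξ).hasFDerivAt
    rw [show w = fun η => gaussVortexProfile η * u η from rfl, (hGd.fun_mul hud).fderiv]
    simp only [add_apply, smul_apply, smul_eq_mul, fderiv_gaussVortexProfile_apply, inner_self_perp,
      mul_zero, add_zero]
  have hB : Integrable fun ξ => (gaussVortexProfile ξ)⁻¹ * ((8 * Real.pi)⁻¹ * burgersPhi (‖ξ‖ ^ 2 / 4)) *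
      (fderiv ℝ w ξ (perp ξ)) ^ 2 := by
    refine integrable_of_abs_le_mul_gauss ((hGinvC.continuous.mul hΩc).mul (hDc.pow 2))
      ((8 * Real.pi)⁻¹ * M ^ 2) fun ξ => ?_
    have hDu : |fderiv ℝ u ξ (perp ξ)| ≤ M * ‖ξ‖ := by
      calc |fderiv ℝ u ξ (perp ξ)| = ‖fderiv ℝ u ξ (perp ξ)‖ := (Real.norm_eq_abs _).symm
        _ ≤ ‖fderiv ℝ u ξ‖ * ‖perp ξ‖ := ContinuousLinearMap.le_opNorm _ _
        _ ≤ M * ‖ξ‖ := by rw [norm_perp]; exact mul_le_mul_of_nonneg_right (h1 ξ) (norm_nonneg _)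
    rw [hDw ξ]
    exact theta_integrand_le (hGpos ξ) (burgersPhi_pos _).le (burgersPhi_le_one (by positivity)) h8π hDu
      (norm_nonneg ξ)
  have hN : Integrable fun ξ => (gaussVortexProfile ξ)⁻¹ * w ξ ^ 2 :=
    (integrable_gauss_mul_sq hu h0).congr (Eventually.of_forall fun ξ => (inv_mul_mul_sq (hGpos ξ).ne').symm)
  have hY : Integrable fun ξ => (gaussVortexProfile ξ)⁻¹ * (w ξ ^ 2 + ‖gradient w ξ‖ ^ 2) :=
    (memGWSobolev_gaussVortexProfile_mul hu h0 h1).2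
  -- ### the profile `ψ` and the radial multiplier `m = ψ′ − ψ/4`
  have hψ01 : ∀ s, 0 ≤ ψ s ∧ ψ s ≤ 1 := fun s => by rw [hψdef]; exact hχ01 _
  have hψ0 : ∀ s, 4 * R ^ 2 ≤ s → ψ s = 0 := by
    intro s hs
    rw [hψdef]
    apply hχ0
    have hn1 : ‖(EuclideanSpace.single 0 1 : EuclideanSpace ℝ (Fin 2))‖ = 1 := by simp
    have h2R : (2 * R) ^ 2 = 4 * R ^ 2 := by ring
    rw [norm_smul, Real.norm_of_nonneg (Real.sqrt_nonneg _), hn1, mul_one]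
    calc 2 * R = Real.sqrt ((2 * R) ^ 2) := (Real.sqrt_sq (by positivity)).symm
      _ ≤ Real.sqrt s := Real.sqrt_le_sqrt (by rw [h2R]; exact hs)
  have hψ'0 : ∀ s, 4 * R ^ 2 < s → deriv ψ s = 0 := by
    intro s hs
    have hev : ψ =ᶠ[𝓝 s] fun _ => (0 : ℝ) := by
      filter_upwards [Ioi_mem_nhds hs] with s' hs' using hψ0 s' hs'.le
    rw [hev.deriv_eq, deriv_const]
  have hψ'b : ∀ ξ : EuclideanSpace ℝ (Fin 2), 2 * |deriv ψ (‖ξ‖ ^ 2)| * ‖ξ‖ ≤ 4 / R := by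
    intro ξ
    have := hχD ξ
    rwa [(hχd ξ).fderiv, norm_smul, innerSL_apply_norm, Real.norm_eq_abs, abs_mul, abs_of_pos two_pos] at this
  have hgradχ : ∀ ξ v, ⟪gradient χ ξ, v⟫ = 2 * deriv ψ (‖ξ‖ ^ 2) * ⟪ξ, v⟫ := by
    intro ξ v
    rw [inner_gradient_left, (hχd ξ).fderiv, smul_apply, innerSL_apply_apply, smul_eq_mul]
  have hgradχn : ∀ ξ, ‖gradient χ ξ‖ ≤ 4 / R := fun ξ => by
    rw [gradient, LinearIsometryEquiv.norm_map]; exact hχD ξ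
  have hψ1 : ContDiff ℝ 1 ψ := hψs.of_le (mod_cast le_top)
  have hψ'1 : ContDiff ℝ 1 (deriv ψ) := (contDiff_infty_iff_deriv.1 hψs).2.of_le (mod_cast le_top)
  set m : EuclideanSpace ℝ (Fin 2) → ℝ := fun ξ => deriv ψ (‖ξ‖ ^ 2) - ψ (‖ξ‖ ^ 2) / 4 with hm
  have hmC : ContDiff ℝ 1 m :=
    (hψ'1.comp (contDiff_norm_sq ℝ)).sub ((hψ1.comp (contDiff_norm_sq ℝ)).div_const 4)
  have hm0 : ∀ ξ : EuclideanSpace ℝ (Fin 2), 2 * R < ‖ξ‖ → m ξ = 0 := by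
    intro ξ hξ
    have h4 := four_mul_sq_lt_sq hR0 hξ
    simp only [hm]
    rw [hψ'0 _ h4, hψ0 _ h4.le]
    norm_num
  have hmb : ∀ ξ : EuclideanSpace ℝ (Fin 2), ‖ξ‖ ≤ 2 * R →
      |m ξ * (b₁ * ξ 0 * ξ 1 + b₂ / 2 * (ξ 1 ^ 2 - ξ 0 ^ 2))| ≤ 5 / 2 * β * R ^ 2 := fun ξ hξ =>
    abs_sub_div_four_mul_le hβ hR (norm_nonneg ξ) hξ (hψ'b ξ) (hψ01 _).1 (hψ01 _).2
      (abs_strainPotential_le hβ hb ξ)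
  -- the radial weight `ρ = m G⁻¹` of the angular integration by parts
  set ρ : EuclideanSpace ℝ (Fin 2) → ℝ := fun ξ => m ξ * (gaussVortexProfile ξ)⁻¹ with hρ
  have hρC : ContDiff ℝ 1 ρ := hmC.mul hGinvC
  have hρrad : ∀ ξ η : EuclideanSpace ℝ (Fin 2), ‖ξ‖ = ‖η‖ → ρ ξ = ρ η := fun ξ η h => by
    simp only [hρ, hm, gaussVortexProfile, h]
  have hρ0 : ∀ ξ : EuclideanSpace ℝ (Fin 2), 2 * R < ‖ξ‖ → ρ ξ = 0 := fun ξ hξ => by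
    simp only [hρ]; rw [hm0 ξ hξ, zero_mul]
  have hρc : HasCompactSupport ρ := HasCompactSupport.intro hK fun ξ hξ => hρ0 ξ (hout ξ hξ)
  -- `G⁻¹ w² P = ρ ⟪ξ, Bξ⟫ w²` with `P = ½ ∇χ·Bξ − ¼ χ ξ·Bξ`
  have hP : ∀ ξ, (gaussVortexProfile ξ)⁻¹ * w ξ ^ 2 *
      (1 / 2 * ⟪gradient χ ξ, toLp 2 ![b₁ * ξ 0 + b₂ * ξ 1, b₂ * ξ 0 - b₁ * ξ 1]⟫ -
        1 / 4 * χ ξ * ⟪ξ, toLp 2 ![b₁ * ξ 0 + b₂ * ξ 1, b₂ * ξ 0 - b₁ * ξ 1]⟫) =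
      ρ ξ * (b₁ * (ξ 0 ^ 2 - ξ 1 ^ 2) + 2 * b₂ * ξ 0 * ξ 1) * w ξ ^ 2 := by
    intro ξ
    rw [hgradχ, hχψ ξ, inner_strain_self]
    simp only [hρ, hm]
    ring
  -- ### support and size of `Sw`
  have hSw0 : ∀ ξ, 2 * R < ‖ξ‖ → Sw ξ = 0 := by
    intro ξ hξ
    show χ ξ * _ + ⟪gradient χ ξ, _⟫ * w ξ = 0
    rw [hgradχ, hχ0 ξ hξ.le, hψ'0 _ (four_mul_sq_lt_sq hR0 hξ)]
    ring
  have hSwb : ∀ ξ, ‖ξ‖ ≤ 2 * R → |Sw ξ| ≤ 2 * β * R * ‖gradient w ξ‖ + 8 * β * |w ξ| := by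
    intro ξ hξ
    have hVle : ‖toLp 2 ![b₁ * ξ 0 + b₂ * ξ 1, b₂ * ξ 0 - b₁ * ξ 1]‖ ≤ 2 * β * R :=
      calc _ ≤ β * ‖ξ‖ := norm_strain_le hβ hb ξ
        _ ≤ β * (2 * R) := mul_le_mul_of_nonneg_left hξ hβ
        _ = 2 * β * R := by ring
    have e1 : |χ ξ * ⟪toLp 2 ![b₁ * ξ 0 + b₂ * ξ 1, b₂ * ξ 0 - b₁ * ξ 1], gradient w ξ⟫| ≤
        2 * β * R * ‖gradient w ξ‖ := by
      rw [abs_mul, abs_of_nonneg (hχ01 ξ).1]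
      calc _ ≤ 1 * (‖toLp 2 ![b₁ * ξ 0 + b₂ * ξ 1, b₂ * ξ 0 - b₁ * ξ 1]‖ * ‖gradient w ξ‖) :=
            mul_le_mul (hχ01 ξ).2 (abs_real_inner_le_norm _ _) (abs_nonneg _) zero_le_one
        _ ≤ 2 * β * R * ‖gradient w ξ‖ := by
            rw [one_mul]; exact mul_le_mul_of_nonneg_right hVle (norm_nonneg _)
    have e2 : |⟪gradient χ ξ, toLp 2 ![b₁ * ξ 0 + b₂ * ξ 1, b₂ * ξ 0 - b₁ * ξ 1]⟫ * w ξ| ≤ 8 * β * |w ξ| := by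
      rw [abs_mul]
      refine mul_le_mul_of_nonneg_right ?_ (abs_nonneg _)
      calc _ ≤ ‖gradient χ ξ‖ * ‖toLp 2 ![b₁ * ξ 0 + b₂ * ξ 1, b₂ * ξ 0 - b₁ * ξ 1]‖ :=
            abs_real_inner_le_norm _ _
        _ ≤ 4 / R * (2 * β * R) :=
            mul_le_mul (hgradχn ξ) hVle (norm_nonneg _) (div_nonneg (by norm_num) hR0.le)
        _ = 8 * β * (R * R⁻¹) := by ring
        _ = 8 * β := by rw [mul_inv_cancel₀ hRne, mul_one]
    exact (abs_add_le _ _).trans (add_le_add e1 e2)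
  have hSwc : HasCompactSupport Sw := HasCompactSupport.intro hK fun ξ hξ => hSw0 ξ (hout ξ hξ)
  have hSwcont : Continuous Sw := (hχs.continuous.mul (hVc.inner hgradwc)).add ((hgradχc.inner hVc).mul hwc)
  -- ### the two pointwise bounds behind the Cauchy–Schwarz steps
  have hpt4 : ∀ ξ, ((gaussVortexProfile ξ)⁻¹ * Sw ξ) ^ 2 /
      ((gaussVortexProfile ξ)⁻¹ * ((8 * Real.pi)⁻¹ * burgersPhi (‖ξ‖ ^ 2 / 4))) ≤
      (80 * β * R ^ 2) ^ 2 * ((gaussVortexProfile ξ)⁻¹ * (w ξ ^ 2 + ‖gradient w ξ‖ ^ 2)) := by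
    intro ξ
    rcases le_or_gt ‖ξ‖ (2 * R) with hξ | hξ
    · exact strain_pointwise_dtheta (inv_pos.2 (hGpos ξ)) (hΩpos ξ) (one_le_mul_omega_of_norm_le hR hξ) hR
        (hSwb ξ hξ)
    · rw [hSw0 ξ hξ, mul_zero, zero_pow two_ne_zero, zero_div]
      exact mul_nonneg (sq_nonneg _) (mul_nonneg (inv_pos.2 (hGpos ξ)).le
        (add_nonneg (sq_nonneg _) (sq_nonneg _)))
  have hpt3 : ∀ ξ, (-2 * (ρ ξ * (b₁ * ξ 0 * ξ 1 + b₂ / 2 * (ξ 1 ^ 2 - ξ 0 ^ 2)) * w ξ)) ^ 2 /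
      ((gaussVortexProfile ξ)⁻¹ * ((8 * Real.pi)⁻¹ * burgersPhi (‖ξ‖ ^ 2 / 4))) ≤
      (40 * β * R ^ 3) ^ 2 * ((gaussVortexProfile ξ)⁻¹ * w ξ ^ 2) := by
    intro ξ
    rcases le_or_gt ‖ξ‖ (2 * R) with hξ | hξ
    · exact strain_pointwise_w (inv_pos.2 (hGpos ξ)) (hΩpos ξ) (one_le_mul_omega_of_norm_le hR hξ) (hmb ξ hξ)
    · rw [hρ0 ξ hξ, zero_mul, zero_mul, mul_zero, zero_pow two_ne_zero, zero_div]
      exact mul_nonneg (sq_nonneg _) (mul_nonneg (inv_pos.2 (hGpos ξ)).le (sq_nonneg _))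
  -- ### integrability
  have hi1 : Integrable fun ξ => (gaussVortexProfile ξ)⁻¹ * Sw ξ * w ξ :=
    ((hGinvC.continuous.mul hSwcont).mul hwc).integrable_of_hasCompactSupport hSwc.mul_left.mul_right
  have hi2 : Integrable fun ξ => (gaussVortexProfile ξ)⁻¹ * Sw ξ * fderiv ℝ w ξ (perp ξ) :=
    ((hGinvC.continuous.mul hSwcont).mul hDc).integrable_of_hasCompactSupport hSwc.mul_left.mul_right
  have hA4 : Integrable fun ξ => ((gaussVortexProfile ξ)⁻¹ * Sw ξ) ^ 2 /
      ((gaussVortexProfile ξ)⁻¹ * ((8 * Real.pi)⁻¹ * burgersPhi (‖ξ‖ ^ 2 / 4))) := by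
    refine (((hGinvC.continuous.mul hSwcont).pow 2).div (hGinvC.continuous.mul hΩc)
      fun ξ => (hWpos ξ).ne').integrable_of_hasCompactSupport (HasCompactSupport.intro hK fun ξ hξ => ?_)
    show ((gaussVortexProfile ξ)⁻¹ * Sw ξ) ^ 2 / _ = 0
    rw [hSw0 ξ (hout ξ hξ), mul_zero, zero_pow two_ne_zero, zero_div]
  have hA3 : Integrable fun ξ => (-2 * (ρ ξ * (b₁ * ξ 0 * ξ 1 + b₂ / 2 * (ξ 1 ^ 2 - ξ 0 ^ 2)) * w ξ)) ^ 2 /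
      ((gaussVortexProfile ξ)⁻¹ * ((8 * Real.pi)⁻¹ * burgersPhi (‖ξ‖ ^ 2 / 4))) := by
    refine (((continuous_const.mul ((hρC.continuous.mul (contDiff_strainPotential b₁ b₂ (n := 0)).continuous).mul
      hwc)).pow 2).div (hGinvC.continuous.mul hΩc) fun ξ => (hWpos ξ).ne').integrable_of_hasCompactSupport
      (HasCompactSupport.intro hK fun ξ hξ => ?_)
    show (-2 * (ρ ξ * _ * w ξ)) ^ 2 / _ = 0
    rw [hρ0 ξ (hout ξ hξ), zero_mul, zero_mul, mul_zero, zero_pow two_ne_zero, zero_div]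
  -- ### (iv) the pairing with the angular derivative
  have hCS4 : |∫ ξ, (gaussVortexProfile ξ)⁻¹ * Sw ξ * fderiv ℝ w ξ (perp ξ)| ≤
      Real.sqrt (∫ ξ, ((gaussVortexProfile ξ)⁻¹ * Sw ξ) ^ 2 /
        ((gaussVortexProfile ξ)⁻¹ * ((8 * Real.pi)⁻¹ * burgersPhi (‖ξ‖ ^ 2 / 4)))) * Real.sqrt Θ :=
    abs_integral_mul_le_sqrt_mul_sqrt_weighted (fun ξ => (gaussVortexProfile ξ)⁻¹ * Sw ξ)
      (fun ξ => fderiv ℝ w ξ (perp ξ)) _ hWpos hA4 hB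
  have hA4le : ∫ ξ, ((gaussVortexProfile ξ)⁻¹ * Sw ξ) ^ 2 /
      ((gaussVortexProfile ξ)⁻¹ * ((8 * Real.pi)⁻¹ * burgersPhi (‖ξ‖ ^ 2 / 4))) ≤
      (80 * β * R ^ 2) ^ 2 * ∫ ξ, (gaussVortexProfile ξ)⁻¹ * (w ξ ^ 2 + ‖gradient w ξ‖ ^ 2) := by
    rw [← integral_const_mul]
    exact integral_mono hA4 (hY.const_mul _) hpt4
  have h4 : |∫ ξ, (gaussVortexProfile ξ)⁻¹ * Sw ξ * fderiv ℝ w ξ (perp ξ)| ≤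
      80 * β * R ^ 2 * Real.sqrt (∫ ξ, (gaussVortexProfile ξ)⁻¹ * (w ξ ^ 2 + ‖gradient w ξ‖ ^ 2)) *
        Real.sqrt Θ := by
    refine hCS4.trans ?_
    rw [← Real.sqrt_sq h80, ← Real.sqrt_mul (sq_nonneg _)]
    exact mul_le_mul_of_nonneg_right (Real.sqrt_le_sqrt hA4le) (Real.sqrt_nonneg _)
  -- ### (iii) the pairing with `w`: strain form identity and one angular integration by parts
  have hχc : HasCompactSupport χ := HasCompactSupport.intro hK fun ξ hξ => hχ0 ξ (hout ξ hξ).le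
  have hI : ∫ ξ, (gaussVortexProfile ξ)⁻¹ * Sw ξ * w ξ =
      ∫ ξ, (-2 * (ρ ξ * (b₁ * ξ 0 * ξ 1 + b₂ / 2 * (ξ 1 ^ 2 - ξ 0 ^ 2)) * w ξ)) * fderiv ℝ w ξ (perp ξ) := by
    have e1 : ∫ ξ, (gaussVortexProfile ξ)⁻¹ * Sw ξ * w ξ = ∫ ξ, (gaussVortexProfile ξ)⁻¹ * w ξ *
        (χ ξ * ⟪toLp 2 ![b₁ * ξ 0 + b₂ * ξ 1, b₂ * ξ 0 - b₁ * ξ 1], gradient w ξ⟫ +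
          ⟪gradient χ ξ, toLp 2 ![b₁ * ξ 0 + b₂ * ξ 1, b₂ * ξ 0 - b₁ * ξ 1]⟫ * w ξ) :=
      integral_congr_ae (Eventually.of_forall fun ξ => by show _ * (_ + _) * _ = _; ring)
    rw [e1, coreStrain_form_identity b₁ b₂ χ w hχ1' hχc hw1, integral_congr_ae (Eventually.of_forall hP),
      integral_radial_mul_strain_mul_sq b₁ b₂ hρC hρc hρrad hw1, ← integral_const_mul]
    refine integral_congr_ae (Eventually.of_forall fun ξ => ?_)
    simp only
    ring
  have hCS3 : |∫ ξ, (-2 * (ρ ξ * (b₁ * ξ 0 * ξ 1 + b₂ / 2 * (ξ 1 ^ 2 - ξ 0 ^ 2)) * w ξ)) *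
      fderiv ℝ w ξ (perp ξ)| ≤
      Real.sqrt (∫ ξ, (-2 * (ρ ξ * (b₁ * ξ 0 * ξ 1 + b₂ / 2 * (ξ 1 ^ 2 - ξ 0 ^ 2)) * w ξ)) ^ 2 /
        ((gaussVortexProfile ξ)⁻¹ * ((8 * Real.pi)⁻¹ * burgersPhi (‖ξ‖ ^ 2 / 4)))) * Real.sqrt Θ :=
    abs_integral_mul_le_sqrt_mul_sqrt_weighted _ (fun ξ => fderiv ℝ w ξ (perp ξ)) _ hWpos hA3 hB
  have hA3le : ∫ ξ, (-2 * (ρ ξ * (b₁ * ξ 0 * ξ 1 + b₂ / 2 * (ξ 1 ^ 2 - ξ 0 ^ 2)) * w ξ)) ^ 2 /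
      ((gaussVortexProfile ξ)⁻¹ * ((8 * Real.pi)⁻¹ * burgersPhi (‖ξ‖ ^ 2 / 4))) ≤
      (40 * β * R ^ 3) ^ 2 * ∫ ξ, (gaussVortexProfile ξ)⁻¹ * w ξ ^ 2 := by
    rw [← integral_const_mul]
    exact integral_mono hA3 (hN.const_mul _) hpt3
  have h3 : |∫ ξ, (gaussVortexProfile ξ)⁻¹ * Sw ξ * w ξ| ≤
      40 * β * R ^ 3 * Real.sqrt (∫ ξ, (gaussVortexProfile ξ)⁻¹ * w ξ ^ 2) * Real.sqrt Θ := by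
    rw [hI]
    refine hCS3.trans ?_
    rw [← Real.sqrt_sq h40, ← Real.sqrt_mul (sq_nonneg _)]
    exact mul_le_mul_of_nonneg_right (Real.sqrt_le_sqrt hA3le) (Real.sqrt_nonneg _)
  exact ⟨hi1, hi2, h3, h4⟩

end Summit.AnomalousDissipation.AnomalousDissipation.Theorems.MarginalStabilityChainStretchedVortexRows

end
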